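import Mathlib
import Summits.Ventures.Crystal3D.Theorems.StickyWulffConstantTextureLiminfTentCellVolumes
import HarnessLib

/-!
# The tent certificate for fcc grains — classification of the nonempty chambers (eng g8)

Route `StickyWulffConstant` (`Summits/Ventures/Crystal3D`, cell `crystal3d-full`), support toward the crux
`TextureLiminf` (stmt-Ventures-19483), FREE half (tent certificate, TexShadow v6.1).
`exists_label_of_mem_cellOf`: a NONEMPTY chamber `cellOf k m` of the arrangement
`{y_i ∈ ℤ} ∪ {⟪a_j, y⟫ ∈ 2ℤ}` is an up-tetrahedron `labelUp p`, a down-tetrahedron `labelDn p`, or an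
octahedron corner `labelCorner p s` (the classical "five tetrahedra per cube": a unit cube of the integer
grid with EVEN corner sum is `T⁺` plus four corners of the neighbouring octahedra, with ODD corner sum it
is `T⁻` plus four corners).  Proof: integer bookkeeping of the windows `2m_j − ⟪a_j, k⟫ ∈ {…}` read off a
point of the chamber, parity, and the five feasible patterns in each parity class.
Also `exists_mem_cellOf_floor`: a point off all the planes of the arrangement lies in the open chamber of
its floor label.
WHAT THIS IS NOT: the certificate; F-C1 not moved.
-/

noncomputable section

namespace Summit.Ventures.Crystal3D.TentCertificate

open Finset Summit.Ventures.Crystal3D MeasureTheory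
open Literature.Geometry.DiscreteGeometry (intVec intVec_apply)
open scoped RealInnerProductSpace

/-- The `(111)` functionals in coordinates of `y = √2 • x`. -/
theorem inner_normal4_smul (j : Fin 4) (x : EuclideanSpace ℝ (Fin 3)) :
    ⟪intVec (normal4 j), Real.sqrt 2 • x⟫ =
      (normal4 j 0 : ℝ) * (Real.sqrt 2 * x 0) + (normal4 j 1 : ℝ) * (Real.sqrt 2 * x 1) +
        (normal4 j 2 : ℝ) * (Real.sqrt 2 * x 2) := by
  rw [inner_intVec_left]; simp [PiLp.smul_apply, smul_eq_mul]

/-! ## The ten label patterns (integer bookkeeping) -/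

section patterns
variable (k : Fin 3 → ℤ) (m : Fin 4 → ℤ)

/-- even cube, central tetrahedron `T⁺`. -/
theorem label_even_up (c : ℤ) (hc : k 0 + k 1 + k 2 = 2 * c)
    (h0 : 2 * m 0 - (k 0 + k 1 + k 2) = 0) (h1 : 2 * m 1 - (k 0 + k 1 - k 2) = 0)
    (h2 : 2 * m 2 - (k 0 - k 1 + k 2) = 0) (h3 : 2 * m 3 - (-k 0 + k 1 + k 2) = 0) :
    (k, m) = labelUp ![(k 0 + k 1 - k 2) / 2, (k 0 - k 1 + k 2) / 2, (-k 0 + k 1 + k 2) / 2] := by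
  refine Prod.ext (funext fun i => ?_) (funext fun j => ?_)
  · fin_cases i <;> simp [labelUp, fccPoint] <;> omega
  · fin_cases j <;> simp [labelUp] <;> omega

/-- even cube, corner at `k + (1,1,1)`. -/
theorem label_even_c0 (c : ℤ) (hc : k 0 + k 1 + k 2 = 2 * c)
    (h0 : 2 * m 0 - (k 0 + k 1 + k 2) = 2) (h1 : 2 * m 1 - (k 0 + k 1 - k 2) = 0)
    (h2 : 2 * m 2 - (k 0 - k 1 + k 2) = 0) (h3 : 2 * m 3 - (-k 0 + k 1 + k 2) = 0) :
    (k, m) = labelCorner ![(k 0 + k 1 - k 2) / 2, (k 0 - k 1 + k 2) / 2, (-k 0 + k 1 + k 2) / 2 + 1]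
      ![false, false, false] := by
  refine Prod.ext (funext fun i => ?_) (funext fun j => ?_)
  · fin_cases i <;> simp [labelCorner, holeZ, fccPoint] <;> omega
  · fin_cases j <;> simp [labelCorner] <;> omega

/-- even cube, corner at `k + (0,0,1)`. -/
theorem label_even_c1 (c : ℤ) (hc : k 0 + k 1 + k 2 = 2 * c)
    (h0 : 2 * m 0 - (k 0 + k 1 + k 2) = 0) (h1 : 2 * m 1 - (k 0 + k 1 - k 2) = -2)
    (h2 : 2 * m 2 - (k 0 - k 1 + k 2) = 0) (h3 : 2 * m 3 - (-k 0 + k 1 + k 2) = 0) :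
    (k, m) = labelCorner ![(k 0 + k 1 - k 2) / 2 - 1, (k 0 - k 1 + k 2) / 2, (-k 0 + k 1 + k 2) / 2 + 1]
      ![true, true, false] := by
  refine Prod.ext (funext fun i => ?_) (funext fun j => ?_)
  · fin_cases i <;> simp [labelCorner, holeZ, fccPoint] <;> omega
  · fin_cases j <;> simp [labelCorner] <;> omega

/-- even cube, corner at `k + (0,1,0)`. -/
theorem label_even_c2 (c : ℤ) (hc : k 0 + k 1 + k 2 = 2 * c)
    (h0 : 2 * m 0 - (k 0 + k 1 + k 2) = 0) (h1 : 2 * m 1 - (k 0 + k 1 - k 2) = 0)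
    (h2 : 2 * m 2 - (k 0 - k 1 + k 2) = -2) (h3 : 2 * m 3 - (-k 0 + k 1 + k 2) = 0) :
    (k, m) = labelCorner ![(k 0 + k 1 - k 2) / 2, (k 0 - k 1 + k 2) / 2 - 1, (-k 0 + k 1 + k 2) / 2 + 1]
      ![true, false, true] := by
  refine Prod.ext (funext fun i => ?_) (funext fun j => ?_)
  · fin_cases i <;> simp [labelCorner, holeZ, fccPoint] <;> omega
  · fin_cases j <;> simp [labelCorner] <;> omega

/-- even cube, corner at `k + (1,0,0)`. -/
theorem label_even_c3 (c : ℤ) (hc : k 0 + k 1 + k 2 = 2 * c)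
    (h0 : 2 * m 0 - (k 0 + k 1 + k 2) = 0) (h1 : 2 * m 1 - (k 0 + k 1 - k 2) = 0)
    (h2 : 2 * m 2 - (k 0 - k 1 + k 2) = 0) (h3 : 2 * m 3 - (-k 0 + k 1 + k 2) = -2) :
    (k, m) = labelCorner ![(k 0 + k 1 - k 2) / 2, (k 0 - k 1 + k 2) / 2, (-k 0 + k 1 + k 2) / 2]
      ![false, true, true] := by
  refine Prod.ext (funext fun i => ?_) (funext fun j => ?_)
  · fin_cases i <;> simp [labelCorner, holeZ, fccPoint] <;> omega
  · fin_cases j <;> simp [labelCorner] <;> omega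

/-- odd cube, central tetrahedron `T⁻` (top vertex `k + (1,1,1)`). -/
theorem label_odd_dn (c : ℤ) (hc : k 0 + k 1 + k 2 = 2 * c + 1)
    (h0 : 2 * m 0 - (k 0 + k 1 + k 2) = 1) (h1 : 2 * m 1 - (k 0 + k 1 - k 2) = -1)
    (h2 : 2 * m 2 - (k 0 - k 1 + k 2) = -1) (h3 : 2 * m 3 - (-k 0 + k 1 + k 2) = -1) :
    (k, m) = labelDn ![(k 0 + k 1 - k 2 + 1) / 2, (k 0 - k 1 + k 2 + 1) / 2, (-k 0 + k 1 + k 2 + 1) / 2] := by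
  refine Prod.ext (funext fun i => ?_) (funext fun j => ?_)
  · fin_cases i <;> simp [labelDn, fccPoint] <;> omega
  · fin_cases j <;> simp [labelDn] <;> omega

/-- odd cube, corner at `k` itself. -/
theorem label_odd_c0 (c : ℤ) (hc : k 0 + k 1 + k 2 = 2 * c + 1)
    (h0 : 2 * m 0 - (k 0 + k 1 + k 2) = -1) (h1 : 2 * m 1 - (k 0 + k 1 - k 2) = -1)
    (h2 : 2 * m 2 - (k 0 - k 1 + k 2) = -1) (h3 : 2 * m 3 - (-k 0 + k 1 + k 2) = -1) :
    (k, m) = labelCorner ![(k 0 + k 1 - k 2 + 1) / 2 - 1, (k 0 - k 1 + k 2 + 1) / 2 - 1,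
      (-k 0 + k 1 + k 2 + 1) / 2] ![true, true, true] := by
  refine Prod.ext (funext fun i => ?_) (funext fun j => ?_)
  · fin_cases i <;> simp [labelCorner, holeZ, fccPoint] <;> omega
  · fin_cases j <;> simp [labelCorner] <;> omega

/-- odd cube, corner at `k + (1,1,0)`. -/
theorem label_odd_c1 (c : ℤ) (hc : k 0 + k 1 + k 2 = 2 * c + 1)
    (h0 : 2 * m 0 - (k 0 + k 1 + k 2) = 1) (h1 : 2 * m 1 - (k 0 + k 1 - k 2) = 1)
    (h2 : 2 * m 2 - (k 0 - k 1 + k 2) = -1) (h3 : 2 * m 3 - (-k 0 + k 1 + k 2) = -1) :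
    (k, m) = labelCorner ![(k 0 + k 1 - k 2 + 1) / 2, (k 0 - k 1 + k 2 + 1) / 2 - 1,
      (-k 0 + k 1 + k 2 + 1) / 2] ![false, false, true] := by
  refine Prod.ext (funext fun i => ?_) (funext fun j => ?_)
  · fin_cases i <;> simp [labelCorner, holeZ, fccPoint] <;> omega
  · fin_cases j <;> simp [labelCorner] <;> omega

/-- odd cube, corner at `k + (1,0,1)`. -/
theorem label_odd_c2 (c : ℤ) (hc : k 0 + k 1 + k 2 = 2 * c + 1)
    (h0 : 2 * m 0 - (k 0 + k 1 + k 2) = 1) (h1 : 2 * m 1 - (k 0 + k 1 - k 2) = -1)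
    (h2 : 2 * m 2 - (k 0 - k 1 + k 2) = 1) (h3 : 2 * m 3 - (-k 0 + k 1 + k 2) = -1) :
    (k, m) = labelCorner ![(k 0 + k 1 - k 2 + 1) / 2 - 1, (k 0 - k 1 + k 2 + 1) / 2,
      (-k 0 + k 1 + k 2 + 1) / 2] ![false, true, false] := by
  refine Prod.ext (funext fun i => ?_) (funext fun j => ?_)
  · fin_cases i <;> simp [labelCorner, holeZ, fccPoint] <;> omega
  · fin_cases j <;> simp [labelCorner] <;> omega

/-- odd cube, corner at `k + (0,1,1)`. -/
theorem label_odd_c3 (c : ℤ) (hc : k 0 + k 1 + k 2 = 2 * c + 1)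
    (h0 : 2 * m 0 - (k 0 + k 1 + k 2) = 1) (h1 : 2 * m 1 - (k 0 + k 1 - k 2) = -1)
    (h2 : 2 * m 2 - (k 0 - k 1 + k 2) = -1) (h3 : 2 * m 3 - (-k 0 + k 1 + k 2) = 1) :
    (k, m) = labelCorner ![(k 0 + k 1 - k 2 + 1) / 2 - 1, (k 0 - k 1 + k 2 + 1) / 2 - 1,
      (-k 0 + k 1 + k 2 + 1) / 2 + 1] ![true, false, false] := by
  refine Prod.ext (funext fun i => ?_) (funext fun j => ?_)
  · fin_cases i <;> simp [labelCorner, holeZ, fccPoint] <;> omega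
  · fin_cases j <;> simp [labelCorner] <;> omega

end patterns

/-- **Classification of the nonempty chambers.** -/
theorem exists_label_of_mem_cellOf {k : Fin 3 → ℤ} {m : Fin 4 → ℤ} {x : EuclideanSpace ℝ (Fin 3)}
    (hx : x ∈ cellOf k m) :
    ∃ p : Site, (k, m) = labelUp p ∨ (k, m) = labelDn p ∨ ∃ s : Fin 3 → Bool, (k, m) = labelCorner p s := by
  obtain ⟨hk, hm⟩ := (mem_cellOf_iff k m x).1 hx
  have hk0 := hk 0; have hk1 := hk 1; have hk2 := hk 2
  have hm0 := hm 0; have hm1 := hm 1; have hm2 := hm 2; have hm3 := hm 3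
  rw [inner_normal4_smul] at hm0 hm1 hm2 hm3
  simp only [normal4, Matrix.cons_val_zero, Matrix.cons_val_one, Matrix.cons_val, Int.cast_one,
    Int.cast_neg, one_mul, neg_one_mul] at hm0 hm1 hm2 hm3
  -- integer offsets and their real windows
  set e0 : ℤ := 2 * m 0 - (k 0 + k 1 + k 2) with he0
  set e1 : ℤ := 2 * m 1 - (k 0 + k 1 - k 2) with he1
  set e2 : ℤ := 2 * m 2 - (k 0 - k 1 + k 2) with he2
  set e3 : ℤ := 2 * m 3 - (-k 0 + k 1 + k 2) with he3
  have ce0 : (e0 : ℝ) = 2 * m 0 - (k 0 + k 1 + k 2) := by rw [he0]; push_cast; ring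
  have ce1 : (e1 : ℝ) = 2 * m 1 - (k 0 + k 1 - k 2) := by rw [he1]; push_cast; ring
  have ce2 : (e2 : ℝ) = 2 * m 2 - (k 0 - k 1 + k 2) := by rw [he2]; push_cast; ring
  have ce3 : (e3 : ℝ) = 2 * m 3 - (-k 0 + k 1 + k 2) := by rw [he3]; push_cast; ring
  -- integer ranges from the real windows
  have i0 : -1 ≤ e0 ∧ e0 ≤ 2 := by
    constructor
    · have : (-2 : ℝ) < e0 := by linarith [hm0.2, hk0.1, hk1.1, hk2.1]
      have h : (-2 : ℤ) < e0 := by exact_mod_cast this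
      omega
    · have : (e0 : ℝ) < 3 := by linarith [hm0.1, hk0.2, hk1.2, hk2.2]
      have h : e0 < 3 := by exact_mod_cast this
      omega
  have i1 : -2 ≤ e1 ∧ e1 ≤ 1 := by
    constructor
    · have : (-3 : ℝ) < e1 := by linarith [hm1.2, hk0.1, hk1.1, hk2.2]
      have h : (-3 : ℤ) < e1 := by exact_mod_cast this
      omega
    · have : (e1 : ℝ) < 2 := by linarith [hm1.1, hk0.2, hk1.2, hk2.1]
      have h : e1 < 2 := by exact_mod_cast this
      omega
  have i2 : -2 ≤ e2 ∧ e2 ≤ 1 := by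
    constructor
    · have : (-3 : ℝ) < e2 := by linarith [hm2.2, hk0.1, hk1.2, hk2.1]
      have h : (-3 : ℤ) < e2 := by exact_mod_cast this
      omega
    · have : (e2 : ℝ) < 2 := by linarith [hm2.1, hk0.2, hk1.1, hk2.2]
      have h : e2 < 2 := by exact_mod_cast this
      omega
  have i3 : -2 ≤ e3 ∧ e3 ≤ 1 := by
    constructor
    · have : (-3 : ℝ) < e3 := by linarith [hm3.2, hk0.2, hk1.1, hk2.1]
      have h : (-3 : ℤ) < e3 := by exact_mod_cast this
      omega
    · have : (e3 : ℝ) < 2 := by linarith [hm3.1, hk0.1, hk1.2, hk2.2]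
      have h : e3 < 2 := by exact_mod_cast this
      omega
  rcases Int.even_or_odd' (k 0 + k 1 + k 2) with ⟨c, hc | hc⟩
  · -- EVEN: `e0 ∈ {0,2}`, `e_j ∈ {-2,0}`; five feasible patterns
    have h0 : e0 = 0 ∨ e0 = 2 := by omega
    have h1 : e1 = -2 ∨ e1 = 0 := by omega
    have h2 : e2 = -2 ∨ e2 = 0 := by omega
    have h3 : e3 = -2 ∨ e3 = 0 := by omega
    rcases h0 with h0 | h0 <;> rcases h1 with h1 | h1 <;> rcases h2 with h2 | h2 <;> rcases h3 with h3 | h3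
    all_goals
      have c0 : (e0 : ℝ) = _ := congrArg (Int.cast : ℤ → ℝ) h0
      have c1 : (e1 : ℝ) = _ := congrArg (Int.cast : ℤ → ℝ) h1
      have c2 : (e2 : ℝ) = _ := congrArg (Int.cast : ℤ → ℝ) h2
      have c3 : (e3 : ℝ) = _ := congrArg (Int.cast : ℤ → ℝ) h3
      push_cast at c0 c1 c2 c3
    all_goals first
      | (exfalso; linarith)
      | exact ⟨_, Or.inl (label_even_up k m c hc h0 h1 h2 h3)⟩
      | exact ⟨_, Or.inr (Or.inr ⟨_, label_even_c0 k m c hc h0 h1 h2 h3⟩)⟩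
      | exact ⟨_, Or.inr (Or.inr ⟨_, label_even_c1 k m c hc h0 h1 h2 h3⟩)⟩
      | exact ⟨_, Or.inr (Or.inr ⟨_, label_even_c2 k m c hc h0 h1 h2 h3⟩)⟩
      | exact ⟨_, Or.inr (Or.inr ⟨_, label_even_c3 k m c hc h0 h1 h2 h3⟩)⟩
  · -- ODD: `e_j ∈ {-1,1}`; five feasible patterns
    have h0 : e0 = -1 ∨ e0 = 1 := by omega
    have h1 : e1 = -1 ∨ e1 = 1 := by omega
    have h2 : e2 = -1 ∨ e2 = 1 := by omega
    have h3 : e3 = -1 ∨ e3 = 1 := by omega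
    rcases h0 with h0 | h0 <;> rcases h1 with h1 | h1 <;> rcases h2 with h2 | h2 <;> rcases h3 with h3 | h3
    all_goals
      have c0 : (e0 : ℝ) = _ := congrArg (Int.cast : ℤ → ℝ) h0
      have c1 : (e1 : ℝ) = _ := congrArg (Int.cast : ℤ → ℝ) h1
      have c2 : (e2 : ℝ) = _ := congrArg (Int.cast : ℤ → ℝ) h2
      have c3 : (e3 : ℝ) = _ := congrArg (Int.cast : ℤ → ℝ) h3
      push_cast at c0 c1 c2 c3
    all_goals first
      | (exfalso; linarith)
      | exact ⟨_, Or.inr (Or.inl (label_odd_dn k m c hc h0 h1 h2 h3))⟩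
      | exact ⟨_, Or.inr (Or.inr ⟨_, label_odd_c0 k m c hc h0 h1 h2 h3⟩)⟩
      | exact ⟨_, Or.inr (Or.inr ⟨_, label_odd_c1 k m c hc h0 h1 h2 h3⟩)⟩
      | exact ⟨_, Or.inr (Or.inr ⟨_, label_odd_c2 k m c hc h0 h1 h2 h3⟩)⟩
      | exact ⟨_, Or.inr (Or.inr ⟨_, label_odd_c3 k m c hc h0 h1 h2 h3⟩)⟩

end Summit.Ventures.Crystal3D.TentCertificate

end
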